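import Summits.CriticalPhenomena.SAWScalingLimit.Theses.SAWRestrictionRigidity
import Summits.CriticalPhenomena.SAWScalingLimit.Theses.SAWConfRestriction
import Summits.CriticalPhenomena.SAWScalingLimit.Theses.SAWLoopFugacityFlow
import Literature.Probability.RandomPlanarGeometry.SAWScalingLimitFamily
import HarnessLib

/-!
# Crux `LimitExists` (stmt-CriticalPhenomena-1371), line `registered` — what the carrier stub (S) adds

Loss analysis of the registered stub (S) = `SAWLoopFugacityFlow.SimpleSubseqLimits`
(stmt-CriticalPhenomena-4982) of the line `registered` (`Cruxes/LimitExists/Lines/birth.lean`; items form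
`LimitExists_of_items : EventualTight → SimpleSubseqLimits → AvoidanceCocycleLimit → LimitExists`).
Modulo the crux, (S) is EXACTLY the item `SAWConfRestriction.SimpleOfLimit` (stmt-CriticalPhenomena-0774:
every full limit is carried by simple chords meeting `∂D` only at the marked points):

* `simpleSubseqLimits_of_limitExists_of_simpleOfLimit : LimitExists → SimpleOfLimit → SimpleSubseqLimits` —
  when the full limit `P` exists, every probability subsequential limit `ν` along any endpoint
  approximation and mesh sequence IS `P D` (bounded continuous integrals determine finite Borel measures,
  limits in `ℝ` are unique), so it inherits simplicity / boundary avoidance from `SimpleOfLimit` and the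
  endpoint and confinement clauses from chordality;
* `simpleOfLimit_of_simpleSubseqLimits : SimpleSubseqLimits → SimpleOfLimit` (unconditionally: a full
  limit is a subsequential limit along the reference meshes `1/(n+1)` of some endpoint approximation,
  `SAW.exists_isEndpointApprox`).

(The same equivalence is recorded for the twin decl `SAWConePseudogroup.SimpleOfLimit` in the crux workfile
`Cruxes/SimpleOfLimit/Lines/birth.lean`; this file is its tree form for the `LimitExists` line.)
Everything proved, standard axioms. [cite: BillingsleyCPM1999, Thm. 1.2]
-/

noncomputable section

open Literature.Probability.RandomPlanarGeometry Literature.Probability.RandomPlanarGeometry.SAW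
  Literature.Probability.LatticeModels Literature.Probability MeasureTheory Filter Topology Set
open scoped NNReal ENNReal BoundedContinuousFunction

namespace Summit.CriticalPhenomena.SAWScalingLimit.Theorems.SAWRestrictionRigidityLimitExists

open Summit.CriticalPhenomena.SAWScalingLimit.Theses.SAWRestrictionRigidity (LimitExists)
open Summit.CriticalPhenomena.SAWScalingLimit.Theses.SAWConfRestriction (SimpleOfLimit)
open Summit.CriticalPhenomena.SAWScalingLimit.Theses.SAWLoopFugacityFlow (SimpleSubseqLimits)

/-- **A subsequential limit of a domain with a full limit is the full limit.**  If `P D` is the weak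
limit of the pushed critical SAW laws of `(D; a_δ, b_δ)` along `δ → 0⁺` and the probability measure `ν`
is their weak limit along a mesh sequence `sₙ → 0⁺`, then `ν = P D` (integrals of bounded continuous
functions agree by uniqueness of limits in `ℝ`; they determine finite Borel measures on the metric space
`CurveClass ℂ`). [cite: BillingsleyCPM1999, Thm. 1.2] -/
theorem eq_of_subseqLimit_of_tendstoLaw {D : DobrushinDomain} {a b : ℝ → Site 2}
    {P ν : Measure (CurveClass ℂ)} [IsProbabilityMeasure P] [IsProbabilityMeasure ν]
    (hlim : TendstoLaw (fun δ (γ : DomainSAW D.carrier δ (a δ) (b δ)) => γ.curve)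
      (fun δ => law D.carrier δ (a δ) (b δ)) id P)
    {s : ℕ → ℝ} (hs : Tendsto s atTop (𝓝[>] (0 : ℝ)))
    (hw : ∀ f : CurveClass ℂ →ᵇ ℝ, Tendsto
      (fun n => ∫ γ, f γ.curve ∂law D.carrier (s n) (a (s n)) (b (s n))) atTop (𝓝 (∫ x, f x ∂ν))) :
    ν = P := by
  refine ext_of_forall_integral_eq_of_IsFiniteMeasure fun f => ?_
  have h2 : Tendsto (fun n => ∫ γ, f γ.curve ∂law D.carrier (s n) (a (s n)) (b (s n))) atTop
      (𝓝 (∫ x, f x ∂P)) := by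
    simpa only [id_eq, Function.comp_def] using (hlim f).comp hs
  exact tendsto_nhds_unique (hw f) h2

/-- **`LimitExists → SimpleOfLimit → SimpleSubseqLimits`**: given the crux, the registered stub (S) (item
stmt-CriticalPhenomena-4982) follows from the item `SimpleOfLimit` (stmt-CriticalPhenomena-0774) — every
probability subsequential limit is the full limit `P D` (`eq_of_subseqLimit_of_tendstoLaw`), which is
simple and boundary-avoiding by `SimpleOfLimit` and has the endpoint / confinement clauses by chordality.
[cite: BillingsleyCPM1999, Thm. 1.2] -/
theorem simpleSubseqLimits_of_limitExists_of_simpleOfLimit : Summit.CriticalPhenomena.SAWScalingLimit.Theses.SAWRestrictionRigidity.LimitExists → Summit.CriticalPhenomena.SAWScalingLimit.Theses.SAWConfRestriction.SimpleOfLimit → Summit.CriticalPhenomena.SAWScalingLimit.Theses.SAWLoopFugacityFlow.SimpleSubseqLimits := by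
  rintro ⟨P, hPch, hPlim⟩ hSOL D a b hab s ν hs hν hw
  haveI : IsProbabilityMeasure (P D) := (hPch D).1
  haveI := hν
  have hνP : ν = P D := eq_of_subseqLimit_of_tendstoLaw (hPlim D a b hab) hs hw
  rw [hνP]
  filter_upwards [hSOL P hPch hPlim D, (hPch D).2] with c h1 h2
  exact ⟨h1.1, h2.1, h2.2.1, h2.2.2, h1.2⟩

/-- **`SimpleSubseqLimits → SimpleOfLimit`** (no existence input needed): a full limit `P D` is the
subsequential limit along the reference meshes `1/(n+1)` of some endpoint approximation of `D`
(`SAW.exists_isEndpointApprox`), so it inherits the carrier clause. [cite: BillingsleyCPM1999, Thm. 1.2] -/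
theorem simpleOfLimit_of_simpleSubseqLimits : Summit.CriticalPhenomena.SAWScalingLimit.Theses.SAWLoopFugacityFlow.SimpleSubseqLimits → Summit.CriticalPhenomena.SAWScalingLimit.Theses.SAWConfRestriction.SimpleOfLimit := by
  intro h P hPch hlim D
  obtain ⟨a, b, hab⟩ := SAW.exists_isEndpointApprox D
  haveI : IsProbabilityMeasure (P D) := (hPch D).1
  -- the reference mesh sequence `1/(n+1) → 0⁺`
  have hs : Tendsto (fun n : ℕ => 1 / ((n : ℝ) + 1)) atTop (𝓝[>] (0 : ℝ)) :=
    tendsto_nhdsWithin_iff.2 ⟨tendsto_one_div_add_atTop_nhds_zero_nat,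
      Filter.Eventually.of_forall fun n => Set.mem_Ioi.2 Nat.one_div_pos_of_nat⟩
  have hw : ∀ f : CurveClass ℂ →ᵇ ℝ, Tendsto (fun n : ℕ => ∫ γ, f γ.curve
      ∂law D.carrier (1 / ((n : ℝ) + 1)) (a (1 / ((n : ℝ) + 1))) (b (1 / ((n : ℝ) + 1)))) atTop
      (𝓝 (∫ x, f x ∂(P D))) := fun f => by
    simpa only [id_eq, Function.comp_def] using (hlim D a b hab f).comp hs
  exact (h D a b hab _ (P D) hs inferInstance hw).mono fun c hc => ⟨hc.1, hc.2.2.2.2⟩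

/-- Hence, **modulo the crux `LimitExists`, the stub (S) IS the item `SimpleOfLimit`**. [folklore] -/
theorem simpleSubseqLimits_iff_simpleOfLimit_of_limitExists (hL : LimitExists) :
    SimpleSubseqLimits ↔ SimpleOfLimit :=
  ⟨simpleOfLimit_of_simpleSubseqLimits, simpleSubseqLimits_of_limitExists_of_simpleOfLimit hL⟩

end Summit.CriticalPhenomena.SAWScalingLimit.Theorems.SAWRestrictionRigidityLimitExists

end
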